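import Summits.QuantumFields.YangMills.Theorems.BalabanUVNodesN22W1RelCentredSliceInputsLG
import Summits.QuantumFields.YangMills.Theorems.BalabanUVNodesN22W1RelCentredSliceInputsL2U
import Summits.QuantumFields.YangMills.Theorems.BalabanUVNodesN22W1RelCentredConfigAnalytic

/-!
# BalabanUVNodes ∕ node N22 = NE9 — THE RELATIVE-DISC CENTRED ROAD OVER THE ADMISSIBLE CLASS, MODULE J17-M: THE LEADING-PART LETTERS AT EACH CONFIGURATION FROM LEMMA 2's SENTENCE,
# AND EVERY CONFIGURATION OF THE THICKENING GETS THE J10-D RECORD — `SliceInputsL2U → ∀ φ ∈ W, SliceInputsLG … φ …` (the twenty-eight Taylor fields DERIVED with module 48's constants and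
# CONFIGURATION-DEPENDENT leading parts `cubicPart (Wc Z t φ Y)`, `linPart (Oc Z t old φ Y)`; `hMan` ∕ `hVan` by module J11 as in J12-M)

Cell `pub-ymgap`, HUMAN RULING D-0062 (Track A), R134 ACCELERATION re-seat `pub-ymgap-dag-n22-c` (strategy s1), generation 10, file J17-M.  THEOREMS ONLY; imports J10-D `…SliceInputsLG`
(the per-configuration record the knit J10c consumes), J17-D `…SliceInputsL2U` (the Lemma-2-sentence record on an open thickening) and J11 `…ConfigAnalytic` (member and centre analytic
in the configuration from the primitive laws) BY NAME; dag-n10-c module 48 `B13Lemma2LeadingParts` (`wilson_letters`, `older_letters`, `loc_of_cubic_of_local`) through J17-D.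
`--supports` K3⁷ `SpineGivenEndpointR13SepCoPH` (stmt-QuantumFields-20544) as a helper.

WHAT.  §0 THE LEADING-PART LETTERS AT EACH CONFIGURATION `ξ ∈ W` of a record `V : SliceInputsL2U … W …` — one application each of module 48 at the complex potentials `V.Wc Z t ξ Y`,
`V.Oc Z t old ξ Y` (real slices `𝒲 Z t ξ Y`, `𝒪 Z t old ξ Y` by `h𝒲re ∕ h𝒪re`): the signs of the derived letters `c₃ = c₃′ = M𝒲∕RA³`, `c₄ = 2M𝒲∕RA⁴`, `c₁ = c₁′ = 2M𝒪∕RA`,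
`c₂ = 4M𝒪∕RA²`; (L1) `h1_of`, (ℓ1) `h1loc_of` (via `Y`-locality through `S Y`), (L2) `h2_of` AGAINST THE CONFIGURATION's OWN CUBIC PART `cubicPart (V.Wc Z t ξ Y)`, (L3) `h3_of`, the
cubic part's homogeneity and measurability; (L0) `h0_of`, (L4) `h4_of`, (L5) `h5_of` AGAINST THE CONFIGURATION's OWN DIFFERENTIAL `linPart (V.Oc Z t old ξ Y)`, (L6) `h6_of`, the
differential's homogeneity and measurability; the `S₀`-locality of `𝒲` from `Y`-locality + `S Y ⊆ S₀`; then J12-M §0's three faces re-run (per-bond multiplicity `hm₃` from the profile +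
(1.26) on the torus, the box-support law at a base point, the centre's quadratic-form letter `h220V0`).  §1 ★ `nonempty_sliceInputsLG_of_lemma2`: for `V : SliceInputsL2U … W …`, a base
point `s₀ > 0`, `ρ_b < 1` and ANY `φ ∈ W`, J10-D's record `SliceInputsLG … φ …` is inhabited — letters `c₀ := M𝒪`, `c₃ = c₃′ := M𝒲∕RA³`, `c₄ := 2M𝒲∕RA⁴`, `c₁ = c₁′ := 2M𝒪∕RA`,
`c₂ := 4M𝒪∕RA²`, `𝒲₃ := Y ↦ cubicPart (V.Wc Z t φ Y)`, `D𝒪 := old Y ↦ linPart (V.Oc Z t old φ Y)` (THE CONFIGURATION's OWN leading parts), the twenty-eight Taylor fields by §0 AT `φ`,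
the shared fields by specialisation at `φ`, `hMan` by J11 §1 and `hVan` by J11 §2 exactly as in J12-M (field list GENERATED by `gen/build_j17m.py` from the tree's J12-M).  Consequence
(module J17-K): the knit J10c runs off ONE Lemma-2-sentence record per slice and table whose leading parts vary with the configuration.

HONEST FRAMING.  Count-neutral bookkeeping (record conversion; the mathematics is module 48's elementary complex analysis and J11's holomorphy under the integral sign, both cited);
nothing of Bałaban's asserted; the record's inhabitant at the datum of record is NODE A's ∕ N09's ∕ N10's ∕ def-W1's business; N22 NOT discharged; one finite four-torus programme at
fixed ε — NOT infinite volume, NOT OS on ℝ⁴, NOT a mass gap, NOT Clay.  0 `sorry`, 0 `def`, standard axioms.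

References (TYPES only): [II] = [Balaban1988RG2Cluster] (1.5) p. 3, (1.26) p. 8, Lemma 1 (1.33)–(1.36) p. 9, (1.38)–(1.39) p. 10, Lemma 2 (1.41)–(1.43) p. 11, (2.2)–(2.3) p. 12,
(2.14) p. 15 ll. 19–20, (2.18)–(2.20) p. 16; [I] = [Balaban1987RG1] §1 p. 263, (2.8)–(2.9) p. 266; [Chae1985] Thm 14.13.
-/

noncomputable section

namespace YMDAG.N22.W1

open Set Metric Matrix
open scoped BigOperators
open Literature.MathematicalPhysics.QuantumFieldTheory.Balaban1983to89
open Literature.MathematicalPhysics.QuantumFieldTheory.Balaban1983to89.TreeLengthTorus (TPt TDom tsys torusTreeLen ineq126_torus tcubeSys)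
open Literature.MathematicalPhysics.QuantumFieldTheory.Balaban1983to89.B12TreeDecay (K₀ K₀_pos)
open Literature.MathematicalPhysics.QuantumFieldTheory.Balaban1983to89.Step (SFConsts)
open Literature.MathematicalPhysics.QuantumFieldTheory.Balaban1983to89.Node00.Sect2 (domSys domCount CPair Setting Residual)
open Literature.MathematicalPhysics.QuantumFieldTheory.Balaban1983to89.Node00.W1
open Literature.MathematicalPhysics.QuantumFieldTheory.Balaban1983to89.B13Lemma2LeadingParts
  (ofRealVec wilsonR cubicPart olderR linPart wilson_letters older_letters loc_of_cubic_of_local)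

variable {N : ℕ}

namespace SliceInputsL2U

variable {c₀ : B13.Consts} {P : Params} {𝔸 : Type*} [NormedRing 𝔸] [NormedAlgebra ℂ 𝔸] [CompleteSpace 𝔸] {M k L : ℕ} [NeZero L]
  {𝔇 : TermDatum214 c₀ P 𝔸 M k L}
  {χu χcu : (Z : (domSys P M (k + 1)).Dom) → (t : TermLabel P M k L) → ((𝔇.𝒦 Z t).Λ → ℝ) → ℝ}
  {𝒲 : (Z : (domSys P M (k + 1)).Dom) → (t : TermLabel P M k L) → CPair P 𝔸 → TDom P.d (L * domCount P M (k + 1)) → ((𝔇.𝒦 Z t).Λ → ℝ) → ℂ}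
  {𝒪 : (Z : (domSys P M (k + 1)).Dom) → (t : TermLabel P M k L) → OlderTerms P 𝔸 M k → CPair P 𝔸 → TDom P.d (L * domCount P M (k + 1)) →
    ((𝔇.𝒦 Z t).Λ → ℝ) → ℂ}
  {c : B13.Consts} {G : Type*} [GaugeGroup G] {Sg : Setting 𝔸 G} {Rz : Residual P 𝔸} {cs : SFConsts} {E₀ κE : ℝ}
  {Z : (domSys P M (k + 1)).Dom} {t : TermLabel P M k L} {W : Set (CPair P 𝔸)} {s₀ a a₅ ρb Mv : ℝ}
  (V : SliceInputsL2U 𝔇 χu χcu 𝒲 𝒪 c Sg Rz cs E₀ κE Z t W s₀ a a₅ ρb Mv)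

/-! ## §0 The leading-part letters at each configuration of the thickening, from Lemma 2's sentence (module 48 ∕ W1-12b's faces, one application each) -/

/-- The analyticity radius is positive (`0 < ρ < RA`). [cite: Balaban1988RG2Cluster, Lemma 2 (1.41) p.11 (bookkeeping)] -/
theorem hRA : 0 < V.RA := V.hρ.trans V.hρRA

/-- The law's Wilson remainder at `(ξ, Y)` IS module 48's `wilsonR (Wc Z t ξ Y)` (from `h𝒲re`). [cite: Balaban1988RG2Cluster, Lemma 2 (1.41) p.11 (bookkeeping)] -/
theorem wilsonR_eq {ξ : CPair P 𝔸} (hξ : ξ ∈ W) (Y : TDom P.d (L * domCount P M (k + 1))) : wilsonR (V.Wc Z t ξ Y) = 𝒲 Z t ξ Y :=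
  funext fun A => (V.h𝒲re ξ hξ Y A).symm

/-- The law's older-terms potential at `(old, ξ, Y)` IS module 48's `olderR (Oc Z t old ξ Y)` (from `h𝒪re`). [cite: Balaban1988RG2Cluster, Lemma 1 (1.33) p.9 (bookkeeping)] -/
theorem olderR_eq {old : OlderTerms P 𝔸 M k} (hold : old ∈ AdmHist (spaceOfRecord (M := M) Sg Rz (fun _ => cs.α₀) (fun _ => cs.α₁)) E₀ κE k) {ξ : CPair P 𝔸} (hξ : ξ ∈ W)
    (Y : TDom P.d (L * domCount P M (k + 1))) : olderR (V.Oc Z t old ξ Y) = 𝒪 Z t old ξ Y :=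
  funext fun A => (V.h𝒪re old hold ξ hξ Y A).symm

/-- `0 ≤ c₃ = c₃′ = M𝒲(Y)∕RA³` on `𝐃`. [cite: Balaban1988RG2Cluster, (1.39) p.10 (bookkeeping)] -/
theorem hc₃ : ∀ Y ∈ t.1, 0 ≤ V.M𝒲 Y / V.RA ^ 3 := fun Y hY => div_nonneg (V.hM𝒲 Y hY) (pow_nonneg V.hRA.le _)

/-- `0 ≤ c₄ = 2M𝒲(Y)∕RA⁴` on `𝐃`. [cite: Balaban1988RG2Cluster, (1.39) p.10 (bookkeeping)] -/
theorem hc₄ : ∀ Y ∈ t.1, 0 ≤ 2 * V.M𝒲 Y / V.RA ^ 4 := fun Y hY => div_nonneg (mul_nonneg two_pos.le (V.hM𝒲 Y hY)) (pow_nonneg V.hRA.le _)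

/-- `0 ≤ c₁ = c₁′ = 2M𝒪(Y)∕RA` on `𝐃`. [cite: Balaban1988RG2Cluster, (1.36) p.9 (bookkeeping)] -/
theorem hc₁ : ∀ Y ∈ t.1, 0 ≤ 2 * V.M𝒪 Y / V.RA := fun Y hY => div_nonneg (mul_nonneg two_pos.le (V.hM𝒪 Y hY)) V.hRA.le

/-- `0 ≤ c₂ = 4M𝒪(Y)∕RA²` on `𝐃`. [cite: Balaban1988RG2Cluster, (1.36) p.9 (bookkeeping)] -/
theorem hc₂ : ∀ Y ∈ t.1, 0 ≤ 4 * V.M𝒪 Y / V.RA ^ 2 := fun Y hY => div_nonneg (mul_nonneg (by norm_num) (V.hM𝒪 Y hY)) (pow_nonneg V.hRA.le _)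

/-- **(L1) AT THE CONFIGURATION `ξ`** (J10-D's `h1` with `c₃ = M𝒲(Y)∕RA³`): `‖𝒲(ξ; Y, A)‖ ≤ (M𝒲(Y)∕RA³)‖A‖³` on the ρ-ball — module 48's `wilson_letters` at `Wc Z t ξ Y`.
[cite: Balaban1988RG2Cluster, (1.39) p.10 and Lemma 2 (1.41) p.11; Balaban1987RG1, (2.8) p.266] -/
theorem h1_of {ξ : CPair P 𝔸} (hξ : ξ ∈ W) :
    ∀ Y ∈ t.1, ∀ A : (𝔇.𝒦 Z t).Λ → ℝ, ‖A‖ ≤ V.ρ → ‖𝒲 Z t ξ Y A‖ ≤ V.M𝒲 Y / V.RA ^ 3 * ‖A‖ ^ 3 := fun Y _ A hA =>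
  (congrArg (‖·‖) (V.h𝒲re ξ hξ Y A)).trans_le ((wilson_letters V.hρRA V.hRA (V.hWd ξ hξ Y) (V.hWM ξ hξ Y) (V.hWB ξ hξ Y)).2.1 A hA)

/-- **(ℓ1) AT THE CONFIGURATION `ξ`** (J10-D's `h1loc`, SAME constant): `‖𝒲(ξ; Y, A)‖ ≤ (M𝒲(Y)∕RA³)‖A‖Σ_{b∈S Y}A_b²` on the ρ-ball — (L1) + `Y`-locality through `S Y`, module 48's
`loc_of_cubic_of_local`. [cite: Balaban1988RG2Cluster, (1.34) p.9 («restricted to the interior of Y»), (1.39) p.10 and (2.20) p.16] -/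
theorem h1loc_of {ξ : CPair P 𝔸} (hξ : ξ ∈ W) :
    ∀ Y ∈ t.1, ∀ A : (𝔇.𝒦 Z t).Λ → ℝ, ‖A‖ ≤ V.ρ → ‖𝒲 Z t ξ Y A‖ ≤ V.M𝒲 Y / V.RA ^ 3 * ‖A‖ * ∑ b ∈ V.S Y, A b ^ 2 := fun Y hY =>
  loc_of_cubic_of_local (V.S Y) (V.hc₃ Y hY) (V.hlocY𝒲 ξ hξ Y hY) (V.h1_of hξ Y hY)

/-- **(L2) AT THE CONFIGURATION `ξ`, AGAINST THE CONFIGURATION's OWN CUBIC PART** (J10-D's `h2` with `c₄ = 2M𝒲(Y)∕RA⁴`, `𝒲₃(Y,·) = cubicPart (Wc Z t ξ Y)`):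
`‖𝒲(ξ;Y,A) − 𝒲₃(ξ;Y,A)‖ ≤ (2M𝒲(Y)∕RA⁴)‖A‖⁴` on the ρ-ball — module 48's `wilson_letters`. [cite: Balaban1988RG2Cluster, (1.39)-(1.40) p.10 and Lemma 2 (1.41) p.11; Balaban1987RG1, (2.8) p.266] -/
theorem h2_of {ξ : CPair P 𝔸} (hξ : ξ ∈ W) :
    ∀ Y ∈ t.1, ∀ A : (𝔇.𝒦 Z t).Λ → ℝ, ‖A‖ ≤ V.ρ → ‖𝒲 Z t ξ Y A - cubicPart (V.Wc Z t ξ Y) A‖ ≤ 2 * V.M𝒲 Y / V.RA ^ 4 * ‖A‖ ^ 4 := fun Y _ A hA => by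
  rw [V.h𝒲re ξ hξ]
  exact (wilson_letters V.hρRA V.hRA (V.hWd ξ hξ Y) (V.hWM ξ hξ Y) (V.hWB ξ hξ Y)).2.2.1 A hA

/-- **(L3) AT THE CONFIGURATION `ξ`, GLOBAL** (J10-D's `h3` with `c₃′ = M𝒲(Y)∕RA³`): `‖𝒲₃(ξ;Y,A)‖ ≤ (M𝒲(Y)∕RA³)‖A‖³` — module 48's `wilson_letters`.
[cite: Balaban1988RG2Cluster, (1.39) p.10 and Lemma 2 (1.41) p.11] -/
theorem h3_of {ξ : CPair P 𝔸} (hξ : ξ ∈ W) :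
    ∀ Y ∈ t.1, ∀ A : (𝔇.𝒦 Z t).Λ → ℝ, ‖cubicPart (V.Wc Z t ξ Y) A‖ ≤ V.M𝒲 Y / V.RA ^ 3 * ‖A‖ ^ 3 := fun Y _ A =>
  (wilson_letters V.hρRA V.hRA (V.hWd ξ hξ Y) (V.hWM ξ hξ Y) (V.hWB ξ hξ Y)).2.2.2.1 A

/-- **The configuration's cubic part is 3-homogeneous under real dilations** (J10-D's `h𝒲₃`), every `Y` — module 48's `wilson_letters`.
[cite: Balaban1988RG2Cluster, Lemma 2 (1.41)-(1.42) p.11; Balaban1987RG1, (2.8) p.266] -/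
theorem cubicPart_smul_of {ξ : CPair P 𝔸} (hξ : ξ ∈ W) :
    ∀ (Y : TDom P.d (L * domCount P M (k + 1))) (r : ℝ) (A : (𝔇.𝒦 Z t).Λ → ℝ), cubicPart (V.Wc Z t ξ Y) (r • A) = (r : ℂ) ^ 3 * cubicPart (V.Wc Z t ξ Y) A := fun Y =>
  (wilson_letters V.hρRA V.hRA (V.hWd ξ hξ Y) (V.hWM ξ hξ Y) (V.hWB ξ hξ Y)).1

/-- **The configuration's cubic part is measurable** (J10-D's `h𝒲₃m`), every `Y`, from the measurability of the real slice — module 48's `wilson_letters`.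
[cite: Balaban1988RG2Cluster, Lemma 2 (1.41) p.11 (bookkeeping)] -/
theorem measurable_cubicPart_of {ξ : CPair P 𝔸} (hξ : ξ ∈ W) : ∀ Y : TDom P.d (L * domCount P M (k + 1)), Measurable (cubicPart (V.Wc Z t ξ Y)) := fun Y =>
  (wilson_letters V.hρRA V.hRA (V.hWd ξ hξ Y) (V.hWM ξ hξ Y) (V.hWB ξ hξ Y)).2.2.2.2 (V.wilsonR_eq hξ Y ▸ V.h𝒲m ξ hξ Y)

/-- **The `S₀`-locality of the Wilson remainder** (J10-D's `hloc𝒲`) from `Y`-locality through `S Y` and `S Y ⊆ S₀`, every `ξ ∈ W`.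
[cite: Balaban1988RG2Cluster, (1.34) p.9 and (2.2)-(2.3) p.12] -/
theorem hloc𝒲_of : ∀ ξ ∈ W, ∀ Y ∈ t.1, ∀ A A' : (𝔇.𝒦 Z t).Λ → ℝ, (∀ b ∈ V.S₀, A b = A' b) → 𝒲 Z t ξ Y A = 𝒲 Z t ξ Y A' :=
  fun ξ hξ Y hY A A' h => V.hlocY𝒲 ξ hξ Y hY A A' fun b hb => h b (V.hSS₀ Y hY b hb)

/-- **(L0) AT THE CONFIGURATION `ξ`** (J10-D's `h0` with `c₀ = M𝒪(Y)`), every admissible history: `‖𝒪(old, ξ; Y, 0)‖ ≤ M𝒪(Y)` — module 48's `older_letters`.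
[cite: Balaban1988RG2Cluster, (1.36) p.9 and Lemma 2 (1.42) p.11] -/
theorem h0_of {old : OlderTerms P 𝔸 M k} (hold : old ∈ AdmHist (spaceOfRecord (M := M) Sg Rz (fun _ => cs.α₀) (fun _ => cs.α₁)) E₀ κE k) {ξ : CPair P 𝔸} (hξ : ξ ∈ W) :
    ∀ Y ∈ t.1, ‖𝒪 Z t old ξ Y 0‖ ≤ V.M𝒪 Y := fun Y _ => by
  rw [V.h𝒪re old hold ξ hξ]
  exact (older_letters V.hρRA V.hRA (V.hOd old hold ξ hξ Y) (V.hOM old hold ξ hξ Y)).1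

/-- **(L4) AT THE CONFIGURATION `ξ`** (J10-D's `h4` with `c₁ = 2M𝒪(Y)∕RA`): `‖𝒪(Y,A) − 𝒪(Y,0)‖ ≤ (2M𝒪(Y)∕RA)‖A‖` on the ρ-ball — module 48's `older_letters`.
[cite: Balaban1988RG2Cluster, (1.36) p.9 and Lemma 2 (1.42) p.11; Balaban1987RG1, (2.12)-(2.13) p.268] -/
theorem h4_of {old : OlderTerms P 𝔸 M k} (hold : old ∈ AdmHist (spaceOfRecord (M := M) Sg Rz (fun _ => cs.α₀) (fun _ => cs.α₁)) E₀ κE k) {ξ : CPair P 𝔸} (hξ : ξ ∈ W) :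
    ∀ Y ∈ t.1, ∀ A : (𝔇.𝒦 Z t).Λ → ℝ, ‖A‖ ≤ V.ρ → ‖𝒪 Z t old ξ Y A - 𝒪 Z t old ξ Y 0‖ ≤ 2 * V.M𝒪 Y / V.RA * ‖A‖ := fun Y _ A hA => by
  rw [V.h𝒪re old hold ξ hξ, V.h𝒪re old hold ξ hξ]
  exact (older_letters V.hρRA V.hRA (V.hOd old hold ξ hξ Y) (V.hOM old hold ξ hξ Y)).2.2.1 A hA

/-- **(L5) AT THE CONFIGURATION `ξ`, AGAINST THE CONFIGURATION's OWN DIFFERENTIAL** (J10-D's `h5` with `c₂ = 4M𝒪(Y)∕RA²`, `D𝒪(old,Y,·) = linPart (Oc Z t old ξ Y)`):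
`‖𝒪(Y,A) − 𝒪(Y,0) − D𝒪(ξ;Y,A)‖ ≤ (4M𝒪(Y)∕RA²)‖A‖²` on the ρ-ball — module 48's `older_letters`. [cite: Balaban1988RG2Cluster, (1.36) p.9 and Lemma 2 (1.42) p.11; Balaban1987RG1, (2.12)-(2.13) p.268] -/
theorem h5_of {old : OlderTerms P 𝔸 M k} (hold : old ∈ AdmHist (spaceOfRecord (M := M) Sg Rz (fun _ => cs.α₀) (fun _ => cs.α₁)) E₀ κE k) {ξ : CPair P 𝔸} (hξ : ξ ∈ W) :
    ∀ Y ∈ t.1, ∀ A : (𝔇.𝒦 Z t).Λ → ℝ, ‖A‖ ≤ V.ρ → ‖𝒪 Z t old ξ Y A - 𝒪 Z t old ξ Y 0 - linPart (V.Oc Z t old ξ Y) A‖ ≤ 4 * V.M𝒪 Y / V.RA ^ 2 * ‖A‖ ^ 2 :=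
  fun Y _ A hA => by
  rw [V.h𝒪re old hold ξ hξ, V.h𝒪re old hold ξ hξ]
  exact (older_letters V.hρRA V.hRA (V.hOd old hold ξ hξ Y) (V.hOM old hold ξ hξ Y)).2.2.2.1 A hA

/-- **(L6) AT THE CONFIGURATION `ξ`, GLOBAL** (J10-D's `h6` with `c₁′ = 2M𝒪(Y)∕RA`): `‖D𝒪(ξ;Y,A)‖ ≤ (2M𝒪(Y)∕RA)‖A‖` — module 48's `older_letters`.
[cite: Balaban1988RG2Cluster, (1.36) p.9 and Lemma 2 (1.42) p.11] -/
theorem h6_of {old : OlderTerms P 𝔸 M k} (hold : old ∈ AdmHist (spaceOfRecord (M := M) Sg Rz (fun _ => cs.α₀) (fun _ => cs.α₁)) E₀ κE k) {ξ : CPair P 𝔸} (hξ : ξ ∈ W) :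
    ∀ Y ∈ t.1, ∀ A : (𝔇.𝒦 Z t).Λ → ℝ, ‖linPart (V.Oc Z t old ξ Y) A‖ ≤ 2 * V.M𝒪 Y / V.RA * ‖A‖ := fun Y _ A =>
  (older_letters V.hρRA V.hRA (V.hOd old hold ξ hξ Y) (V.hOM old hold ξ hξ Y)).2.2.2.2.1 A

/-- **The configuration's differential is 1-homogeneous under real dilations** (J10-D's `hD𝒪`), every `Y` — module 48's `older_letters`.
[cite: Balaban1988RG2Cluster, (1.36) p.9 and Lemma 2 (1.42) p.11] -/
theorem linPart_smul_of {old : OlderTerms P 𝔸 M k} (hold : old ∈ AdmHist (spaceOfRecord (M := M) Sg Rz (fun _ => cs.α₀) (fun _ => cs.α₁)) E₀ κE k) {ξ : CPair P 𝔸} (hξ : ξ ∈ W) :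
    ∀ (Y : TDom P.d (L * domCount P M (k + 1))) (r : ℝ) (A : (𝔇.𝒦 Z t).Λ → ℝ), linPart (V.Oc Z t old ξ Y) (r • A) = (r : ℂ) * linPart (V.Oc Z t old ξ Y) A := fun Y =>
  (older_letters V.hρRA V.hRA (V.hOd old hold ξ hξ Y) (V.hOM old hold ξ hξ Y)).2.1

/-- **The configuration's differential is measurable** (J10-D's `hD𝒪m`), every `Y`, from the measurability of the real slice — module 48's `older_letters`.
[cite: Balaban1988RG2Cluster, Lemma 2 (1.42) p.11 (bookkeeping)] -/
theorem measurable_linPart_of {old : OlderTerms P 𝔸 M k} (hold : old ∈ AdmHist (spaceOfRecord (M := M) Sg Rz (fun _ => cs.α₀) (fun _ => cs.α₁)) E₀ κE k) {ξ : CPair P 𝔸}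
    (hξ : ξ ∈ W) : ∀ Y : TDom P.d (L * domCount P M (k + 1)), Measurable (linPart (V.Oc Z t old ξ Y)) := fun Y =>
  (older_letters V.hρRA V.hRA (V.hOd old hold ξ hξ Y) (V.hOM old hold ξ hξ Y)).2.2.2.2.2 (V.olderR_eq hold hξ Y ▸ V.h𝒪m old hold ξ hξ Y)

/-! ## §0b J12-M §0's three faces re-run on the Lemma-2 record -/

/-- **The box-support law AT A REAL BASE POINT**: the s-free law read at `A := s·B`. [cite: Balaban1987RG1, (2.9) p.266; Balaban1988RG2Cluster, (2.3) p.12] -/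
theorem hbox_smul (s : ℝ) : ∀ B : (𝔇.𝒦 Z t).Λ → ℝ, χu Z t (s • B) ≠ 0 → ∀ b ∈ V.S₀, |(s • B) b| ≤ V.ρ :=
  fun B hB => V.hbox (s • B) hB

/-- `0 ≤ m₃ = C_p·K₀(4·2^d, 2d)`. [cite: Balaban1988RG2Cluster, (2.20) p.16 (bookkeeping)] -/
theorem hm₃0 : 0 ≤ V.Cp * B12TreeDecay.K₀ (4 * 2 ^ P.d) (2 * P.d) :=
  mul_nonneg V.hCp (K₀_pos _ _).le

/-- **THE PER-BOND MULTIPLICITY OF THE RATE WEIGHT, DERIVED** (J12-M §0 `SliceInputsLGU.hm₃`'s proof VERBATIM at the derived cubic letter: cube-location (G), the (2.19) profile (P) and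
(1.26) ON THE TORUS `TreeLengthTorus.ineq126_torus`): `Σ_{Y ∈ 𝐃, b ∈ S Y} R(Y)(M𝒲(Y)∕RA³) ≤ C_p·K₀(4·2^d, 2d)`. [cite: Balaban1988RG2Cluster, (2.19)-(2.20) p.16 and (1.26) p.8] -/
theorem hm₃ : ∀ bd : (𝔇.𝒦 Z t).Λ, ∑ Y ∈ t.1 with bd ∈ V.S Y, V.R Y * (V.M𝒲 Y / V.RA ^ 3) ≤ V.Cp * B12TreeDecay.K₀ (4 * 2 ^ P.d) (2 * P.d) := by
  intro bd
  have h126 := ineq126_torus P.d (L * domCount P M (k + 1)) V.hκp (V.cubeOf bd)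
  calc ∑ Y ∈ t.1 with bd ∈ V.S Y, V.R Y * (V.M𝒲 Y / V.RA ^ 3)
      ≤ ∑ Y ∈ t.1 with bd ∈ V.S Y, V.Cp * Real.exp (-V.κp * (tsys P.d (L * domCount P M (k + 1))).dj Y) :=
        Finset.sum_le_sum fun Y hY => V.hdecay Y (Finset.mem_filter.1 hY).1
    _ ≤ ∑ Y ∈ (tcubeSys P.d (L * domCount P M (k + 1))).above (V.cubeOf bd),
          V.Cp * Real.exp (-V.κp * (tsys P.d (L * domCount P M (k + 1))).dj Y) := by
        refine Finset.sum_le_sum_of_subset_of_nonneg (fun Y hY => ?_) fun Y _ _ => mul_nonneg V.hCp (Real.exp_nonneg _)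
        have hY' := Finset.mem_filter.1 hY
        exact (B12TreeDecay.CubeSystem.mem_above (G := tcubeSys P.d (L * domCount P M (k + 1))) (c := V.cubeOf bd)
          (X := Y)).2 (V.hS Y hY'.1 bd hY'.2)
    _ = V.Cp * ∑ Y ∈ (tcubeSys P.d (L * domCount P M (k + 1))).above (V.cubeOf bd),
          Real.exp (-V.κp * (tsys P.d (L * domCount P M (k + 1))).dj Y) := by rw [Finset.mul_sum]
    _ ≤ V.Cp * B12TreeDecay.K₀ (4 * 2 ^ P.d) (2 * P.d) := mul_le_mul_of_nonneg_left h126 V.hCp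

/-- **THE CENTRE's QUADRATIC-FORM LETTER at every configuration of the thickening, DERIVED** from (L0) at the configuration, the τ-radii and the closure `hw₀` (J12-M §0 `h220V0`):
`Σ|τ||𝒪(old, ξ; Y, 0)| ≤ ½a₀⟨B,B⟩ + w₀`, every admissible history. [cite: Balaban1988RG2Cluster, (2.18)-(2.20) p.16 and Lemma 2 p.11] -/
theorem h220V0 {old : OlderTerms P 𝔸 M k} (hA : old ∈ AdmHist (spaceOfRecord (M := M) Sg Rz (fun _ => cs.α₀) (fun _ => cs.α₁)) E₀ κE k) :
    ∀ ξ ∈ W, ∀ τ : TDom P.d (L * domCount P M (k + 1)) → ℂ, (∀ Y, τ Y ∈ V.Uτ Y) → ∀ B : (𝔇.𝒦 Z t).Λ → ℝ,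
      ∑ Y ∈ t.1, ‖τ Y‖ * ‖𝒪 Z t old ξ Y 0‖ ≤ V.a₀ / 2 * (B ⬝ᵥ B) + V.w₀ := fun _ hξ τ hτ B =>
  ((Finset.sum_le_sum fun Y hY => mul_le_mul (V.hUτR Y hY (τ Y) (hτ Y)) (V.h0_of hA hξ Y hY) (norm_nonneg _) (V.hR Y hY)).trans V.hw₀).trans
    (le_add_of_nonneg_left (mul_nonneg (div_nonneg V.ha₀ two_pos.le) (Finset.sum_nonneg fun i _ => mul_self_nonneg (B i))))

/-! ## §1 Every configuration of the thickening gets the J10-D record, with ITS OWN leading parts -/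

open Classical in
/-- **EVERY CONFIGURATION OF THE THICKENING GETS THE J10-D RECORD, WITH ITS OWN LEADING PARTS**: from a Lemma-2-sentence record `V : SliceInputsL2U … W …` at a base point `s₀ > 0` with
`ρ_b < 1`, the record `SliceInputsLG … φ …` of J10-D is inhabited at EVERY `φ ∈ W` — letters `c₀ := M𝒪`, `c₃ = c₃′ := M𝒲∕RA³`, `c₄ := 2M𝒲∕RA⁴`, `c₁ = c₁′ := 2M𝒪∕RA`, `c₂ := 4M𝒪∕RA²`,
leading parts `𝒲₃ := Y ↦ cubicPart (V.Wc Z t φ Y)` and `D𝒪 := old Y ↦ linPart (V.Oc Z t old φ Y)` (THE CONFIGURATION's OWN), the twenty-eight Taylor fields by §0 at `φ`, the shared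
fields by specialisation at `φ`, the member's φ-analyticity `hMan` by J11 §1 and the centre's `hVan` by J11 §2 from the primitive φ-laws and the letters uniform on `W` ([II] p. 15 ll.
19–20 made a consequence).  Bookkeeping; the mathematics is module 48's and J11's.
[cite: Balaban1988RG2Cluster, Lemma 2 (1.41)-(1.43) p.11, (1.36) p.9, (1.39) p.10, (2.14) p.15, (1.5) p.3; Balaban1987RG1, §1 p.263, (2.8)-(2.9) p.266; Chae1985, Thm 14.13] -/
theorem nonempty_sliceInputsLG_of_lemma2 (V : SliceInputsL2U 𝔇 χu χcu 𝒲 𝒪 c Sg Rz cs E₀ κE Z t W s₀ a a₅ ρb Mv) (hs : 0 < s₀) (hρb1 : ρb < 1)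
    {φ : CPair P 𝔸} (hφ : φ ∈ W) :
    Nonempty (SliceInputsLG 𝔇 χu χcu 𝒲 𝒪 c Sg Rz cs E₀ κE Z t φ s₀ a a₅ ρb Mv) :=
  ⟨{
    Uσ := V.Uσ, Uτ := V.Uτ, γ₂ := V.γ₂, rP := V.rP, qP := V.qP, kap := V.kap, kap' := V.kap', kap'' := V.kap'', θ := V.θ, θE := V.θE, θΓ := V.θΓ, θC := V.θC, KG := V.KG, KΓ := V.KΓ,
    KCs := V.KCs, K₀ := V.K₀, KE := V.KE, KG' := V.KG', KCs' := V.KCs', θΓ' := V.θΓ', θC' := V.θC', θE' := V.θE', a' := V.a', w' := V.w', cE := V.cE, g := V.g, Rb := V.Rb, κ := V.κ,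
    a₀ := V.a₀, w₀ := V.w₀, T := V.T, α₀ := V.α₀, r₁ := V.r₁, TP := V.TP, ac := V.ac, wc := V.wc, hpos := V.hpos, hhalf := V.hhalf, hUσ := V.hUσ, hUτ := V.hUτ, hUexp := V.hUexp,
    hUtau := V.hUtau, hr := V.hr, hr' := V.hr', hsubτ := V.hsubτ, hχ0 := V.hχ0, hχc0 := V.hχc0, hχm := V.hχm, hχcm := V.hχcm, h222 := V.h222, hγ₂ := V.hγ₂, hqP := V.hqP,
    hAhol := V.hAhol φ hφ, hGhol := V.hGhol φ hφ, hAs := V.hAs φ hφ, hfibN := V.hfibN, hkap'' := V.hkap'', hk1 := V.hk1, hk2 := V.hk2, hθE := V.hθE, hθΓ := V.hθΓ, hθC := V.hθC, hKG := V.hKG,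
    hKΓ := V.hKΓ, hKCs := V.hKCs, hK₀ := V.hK₀, hKE := V.hKE, hG := V.hG φ hφ, hΓ₀ := V.hΓ₀, hCs := V.hCs φ hφ, hC216 := V.hC216, hCE := V.hCE, hdΓ := V.hdΓ φ hφ, hdC := V.hdC φ hφ,
    hdE := V.hdE φ hφ, hKG' := V.hKG', hKCs' := V.hKCs', hθΓ' := V.hθΓ', hθC' := V.hθC', hθE' := V.hθE', hθEle := V.hθEle, hθΓle := V.hθΓle, hθR1le := V.hθR1le, hsmallKθ := V.hsmallKθ,
    hc0 := V.hc0, hc := V.hc, hαc := V.hαc, hg := V.hg, hΓq := V.hΓq, hsmall := V.hsmall, hPa := V.hPa, hvol := V.hvol, hχe := V.hχe, hχce := V.hχce, hαc_c := V.hαc_c, hsmall_c := V.hsmall_c,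
    hvol_c := V.hvol_c, hχ1 := V.hχ1, hκ := V.hκ, hboxR := V.hboxR, ha₀ := V.ha₀, hαc_b := V.hαc_b, hsmall_b := V.hsmall_b, hvol_b := V.hvol_b, hα₀ := V.hα₀, hαc_f := V.hαc_f,
    hsmall_f := V.hsmall_f, hr₁ := V.hr₁, hPa1 := V.hPa1, hA := V.hA φ hφ, hθEle0 := V.hθEle0, hθΓle0 := V.hθΓle0, hθR1le0 := V.hθR1le0, hαc_0 := V.hαc_0, hsmall_0 := V.hsmall_0,
    hvol_0 := V.hvol_0, hRb := V.hRb, hTP := V.hTP, hMvT := V.hMvT, hMvP := V.hMvP,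
    𝒲₃ := fun Y => cubicPart (V.Wc Z t φ Y),
    D𝒪 := fun old Y => linPart (V.Oc Z t old φ Y),
    ρ := V.ρ, hρ := V.hρ, h𝒲m := V.h𝒲m φ hφ,
    h𝒲₃m := V.measurable_cubicPart_of hφ,
    h𝒲₃ := V.cubicPart_smul_of hφ,
    R := V.R,
    c₀ := V.M𝒪,
    c₃ := fun Y => V.M𝒲 Y / V.RA ^ 3,
    c₃' := fun Y => V.M𝒲 Y / V.RA ^ 3,
    c₄ := fun Y => 2 * V.M𝒲 Y / V.RA ^ 4,
    c₁ := fun Y => 2 * V.M𝒪 Y / V.RA,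
    c₁' := fun Y => 2 * V.M𝒪 Y / V.RA,
    c₂ := fun Y => 4 * V.M𝒪 Y / V.RA ^ 2,
    hR := V.hR,
    hc₃ := V.hc₃,
    hc₃' := V.hc₃,
    hc₄ := V.hc₄,
    hc₁ := V.hc₁,
    hc₁' := V.hc₁,
    hc₂ := V.hc₂,
    hUτR := V.hUτR,
    h1 := V.h1_of hφ,
    S := V.S,
    h1loc := V.h1loc_of hφ,
    cubeOf := V.cubeOf, hS := V.hS, Cp := V.Cp, κp := V.κp, hCp := V.hCp, hκp := V.hκp, hdecay := V.hdecay,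
    h2 := V.h2_of hφ,
    h3 := V.h3_of hφ,
    S₀ := V.S₀, hbox := V.hbox,
    hloc𝒲 := V.hloc𝒲_of φ hφ,
    δ := V.δ, hδ := V.hδ, h𝒪m := fun old hA => V.h𝒪m old hA φ hφ,
    hD𝒪m := fun old hA => V.measurable_linPart_of hA hφ,
    hD𝒪 := fun old hA => V.linPart_smul_of hA hφ,
    h0 := fun old hA => V.h0_of hA hφ,
    h4 := fun old hA => V.h4_of hA hφ,
    h5 := fun old hA => V.h5_of hA hφ,
    h6 := fun old hA => V.h6_of hA hφ,
    hloc𝒪 := fun old hA => V.hloc𝒪 old hA φ hφ, hOhol := V.hOhol φ hφ, ha' := V.ha', hw' := V.hw', hac := V.hac, hwc := V.hwc, hw₀ := V.hw₀,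
    hMan := fun old hA b hb =>
      analyticOnNhd_memberOfDatum_config_of_localGrowth 𝔇 χu χcu 𝒲 𝒪 Z t old s₀ V.hW c V.hUσ V.hUτ V.hUexp V.hr V.hr' V.hsubτ V.hχ0 V.hχc0 hs V.hρ.le
        V.hAhol V.hAd V.hχm V.hχcm V.h𝒲m V.h𝒲d (V.h𝒪m old hA) (V.h𝒪d old hA) V.hAs V.hGhol V.hGd V.qP V.h222 V.hγ₂ V.hqP
        (R := V.R) (cz := V.M𝒪) (c₁ := fun Y => 2 * V.M𝒪 Y / V.RA) (c₃ := fun Y => V.M𝒲 Y / V.RA ^ 3) V.hR V.hc₃ V.hc₁ V.hUτR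
        (fun ψ hψ => V.h0_of hA hψ) V.S (fun ψ hψ => V.h1loc_of hψ) (fun ψ hψ => V.h4_of hA hψ) V.hm₃0 V.hm₃ V.S₀ (V.hbox_smul s₀) V.hloc𝒲_of (V.hloc𝒪 old hA) V.hfibN
        V.hkap'' V.hk1 V.hk2 V.hθE V.hθΓ V.hθC V.hKG V.hKΓ V.hKCs V.hK₀ V.hKE V.hG V.hΓ₀ V.hCs V.hC216 V.hCE V.hdΓ V.hdC V.hdE hρb1 V.hKG' V.hKCs' V.hθΓ' V.hθC' V.hθE'
        V.ha' V.hw' V.hθEle V.hθΓle V.hθR1le V.hsmallKθ V.hc0 V.hc V.hαc V.hΓq V.hsmall hb φ hφ,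
    hVan := fun old hA hP =>
      analyticOnNhd_centreOfDatum_config_of_primitives 𝔇 𝒪 Z t old (by rw [hP, Finset.card_empty]) V.hW c V.hUσ V.hUτ V.hUexp V.hr V.hr' V.hsubτ
        V.hAhol V.hAd V.hAs V.hA V.hGhol V.hGd (fun Y => V.h𝒪d old hA Y 0) V.hγ₂ V.ha₀ V.hfibN V.hkap'' V.hk1 V.hk2 V.hθE V.hθΓ V.hθC V.hKG V.hKΓ
        V.hKCs V.hK₀ V.hθEle0 V.hθΓle0 V.hθR1le0 V.hG V.hΓ₀ V.hCs V.hC216 V.hdΓ V.hdC V.hdE V.hsmallKθ V.hc0 V.hc V.hαc_0 V.hΓq V.hsmall_0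
        (V.h220V0 hA) φ hφ }⟩

end SliceInputsL2U

end YMDAG.N22.W1

end
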